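import Literature.InformationTheory.QuantumCodes.BivariateBicycleCodes
import HarnessLib
import HarnessLib.Audit.Tags

/-!
# Circuit-level distance `d_circ` of the depth-7 syndrome-measurement circuit of a bivariate-bicycle code
# (venture QEC, experiment cell CDX — definitions only; nothing here asserts a value of `d_circ`)

Source: S. Bravyi, A. W. Cross, J. M. Gambetta, D. Maslov, P. Rall, T. J. Yoder, *High-threshold and
low-overhead fault-tolerant quantum memory*, Nature **627** (2024) 778–782 = arXiv:2308.07915 [BravyiEtAl2024]:
the syndrome cycle (SC) of §5 / Eq. (SCunitary_part) (SI p. 12–13), the circuit-level noise model and the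
linearised ("decoding-matrix") description of §6 (SI p. 15–17), and the definition of the circuit-level distance
(p. 5: "a SM circuit has distance `d_circ` if it takes at least `d_circ` faulty operations in the circuit to
generate an undetectable logical error"; SI p. 17: "`d_circ = min (d^X_circ, d^Z_circ)`").

HONEST FRAMING. This file fixes, computably and operation-by-operation, (1) the SC circuit of a BB code
`QC(A,B)` given the ORDERED terms `A = A₁+A₂+A₃`, `B = B₁+B₂+B₃` (`SMCode`), (2) print's single-fault
locations (every CNOT × a two-qubit Pauli after the gate; every idle data slot × a Pauli; state-preparation
and measurement faults), (3) the effect of a fault SET by Pauli-frame propagation through `Nc` noisy cycles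
that start on a perfect code state and end with a perfect syndrome read-out, (4) `Undetectable`, `LogicalError`,
the number of faulty OPERATIONS `faultCount`, and (5) `circuitDistance S Nc = min faultCount` over undetectable
logical fault sets (`sInf`, junk value `0` if there is none). The effect of a set is the `𝔽₂`-sum of the
single-fault effects (print's linearised model, SI p. 16 "ignores possible cancellations"; for a Clifford
circuit of CNOTs with Pauli faults this sum IS the joint Pauli-frame simulation — a lemma to be proved in
`Theorems/`, not assumed here). Which value `d_circ` takes for `[[72,12,6]]` / `[[144,12,12]]` is a CLAIM
(`CircuitDistance/Claims.lean`), decided only by a kernel-checked certificate.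

Modelling decisions, each with its locator (audited by qec-cdx-crit-1):
* registers `q(X), q(L), q(R), q(Z)` of size `ℓm` (SI p. 12 L19–21); `CNOT_M(a → b)` couples control `q(a,i)`
  to target `q(b, M(i))` with `M(i) = i + (α,β)` for the monomial `M = x^α y^β` (SI p. 12 L14: "`j = A₁(i)` iff
  `A₁` has a one at row `i`, column `j`"; tree convention `BB.toMatrix_monomial_apply`);
* rounds (SI p. 13, Eq. (SCunitary_part)): R1 `CNOT_{A₁}(R→Z)`; R2 `CNOT_{A₂}(X→L)`, `CNOT_{A₃}(R→Z)`;
  R3 `CNOT_{B₂}(X→R)`, `CNOT_{B₁}(L→Z)`; R4 `CNOT_{B₁}(X→R)`, `CNOT_{B₂}(L→Z)`; R5 `CNOT_{B₃}(X→R)`,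
  `CNOT_{B₃}(L→Z)`; R6 `CNOT_{A₁}(X→L)`, `CNOT_{A₂}(R→Z)`; R7 `CNOT_{A₃}(X→L)`; with `InitX q(X)` in R1,
  `MeasZ q(Z)` in R7, `MeasX q(X)` and `InitZ q(Z)` in R8 (SI p. 12 L18: CNOT rounds per register pair,
  "measured in the Z-basis in Round 7", "X-basis in Round 8", "q(Z) is initialized only at Round 8"), hence the
  idle data slots `q(L)`@R1, `q(R)`@R7, `q(L),q(R)`@R8 (= print's `2n` idle locations per cycle, SI p. 15 L60)
  and an IDEAL `InitZ` round before cycle 1 (SI p. 12 footnote; no fault location there, matching print's `98·n·N_c`);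
* faults (SI p. 15 L12–21): faulty CNOT = ideal CNOT followed by a two-qubit Pauli; faulty idle = a Pauli;
  faulty initialisation = the orthogonal state (`Z` after `InitX`, `X` after `InitZ`); faulty measurement =
  flipped outcome. `98·n` single faults per cycle, as in print (L62). (Identity Paulis are allowed as no-op
  "faults": they change no effect and only add to `faultCount`.)
* detectors = syndrome CHANGES (SI p. 16, `m ↦ m'`) per check per cycle, the first cycle compared with the
  perfect initial code state, plus the final perfect syndrome of the residual data error (SI p. 16: "the
  decoder knows the syndrome `s^F` of the final error … acquired by adding one noiseless cycle").
-/

namespace Summit.Ventures.QEC.CircuitDistance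

open Literature.InformationTheory.QuantumCodes

/-! ## Registers, qubits, Pauli frames -/

/-- The four registers of the SM circuit: `X`-check ancillas, left data block, right data block, `Z`-check
ancillas (SI §5 p. 12: "`q(X)`, `q(L)`, `q(R)`, and `q(Z)`, of size `n/2` each"). -/
inductive Reg
  | X | L | R | Z
  deriving DecidableEq, Repr

/-- A physical qubit: a register and a position `i ∈ ℤ_ℓ × ℤ_m`. -/
abbrev Qubit (ℓ m : ℕ) : Type := Reg × BB.Mono ℓ m

/-- A single-qubit Pauli modulo phase as its `(x, z)` bits: `I = (0,0)`, `X = (1,0)`, `Z = (0,1)`, `Y = (1,1)`. -/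
abbrev P1 : Type := Bool × Bool

/-- Componentwise product (XOR of bits) of Paulis modulo phase. -/
def P1.mul (p q : P1) : P1 := (xor p.1 q.1, xor p.2 q.2)

/-- A Pauli frame on all `4ℓm` physical qubits (the error being propagated), modulo phase. -/
abbrev Frame (ℓ m : ℕ) : Type := Qubit ℓ m → P1

variable {ℓ m : ℕ}

/-- Multiply the Pauli `p` into the frame at qubit `q`. -/
def Frame.mulAt (F : Frame ℓ m) (q : Qubit ℓ m) (p : P1) : Frame ℓ m :=
  fun q' => if q' = q then P1.mul (F q') p else F q'

/-- Reset a whole register to the identity frame (ideal `InitX` / `InitZ` erase any error on the ancilla). -/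
def Frame.clearReg (F : Frame ℓ m) (r : Reg) : Frame ℓ m :=
  fun q' => if q'.1 = r then (false, false) else F q'

variable [NeZero ℓ] [NeZero m]

/-- One LAYER of CNOTs `CNOT_M(a → b)` for the monomial `M = x^{μ.1} y^{μ.2}`: control `q(a, i)`, target
`q(b, i + μ)` for every `i` (so target `j` has control `j − μ`). Conjugation of the frame: `X` propagates
control → target, `Z` propagates target → control. Requires `a ≠ b` (always the case below). -/
def Frame.cnotLayer (F : Frame ℓ m) (a b : Reg) (μ : BB.Mono ℓ m) : Frame ℓ m :=
  fun q => if q.1 = b then (xor (F q).1 (F (a, q.2 - μ)).1, (F q).2)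
    else if q.1 = a then ((F q).1, xor (F q).2 (F (b, q.2 + μ)).2)
    else F q

/-! ## The circuit data: ordered terms of `A` and `B` -/

/-- The data the SM circuit needs beyond the code `QC(A,B)`: the ORDERED monomials `A₁, A₂, A₃` and
`B₁, B₂, B₃` (exponent pairs `(α, β)` of `x^α y^β`) with `A = A₁ + A₂ + A₃`, `B = B₁ + B₂ + B₃` — the circuit
(and `d_circ`) depends on the order (SI p. 14: the 936 depth-7 variants). [cite: BravyiEtAl2024, §4 eq. (AB) and SI §5] -/
structure SMCode (ℓ m : ℕ) where
  /-- exponents of `A₁, A₂, A₃` -/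
  a : Fin 3 → ℕ × ℕ
  /-- exponents of `B₁, B₂, B₃` -/
  b : Fin 3 → ℕ × ℕ

/-- The monomial `Aₚ` as a translation `(α, β)` of `ℤ_ℓ × ℤ_m` (exponents reduced `mod ℓ`, `mod m`). -/
def SMCode.amon (S : SMCode ℓ m) (p : Fin 3) : BB.Mono ℓ m := (Fin.ofNat ℓ (S.a p).1, Fin.ofNat m (S.a p).2)

/-- The monomial `B_q` as a translation of `ℤ_ℓ × ℤ_m`. -/
def SMCode.bmon (S : SMCode ℓ m) (p : Fin 3) : BB.Mono ℓ m := (Fin.ofNat ℓ (S.b p).1, Fin.ofNat m (S.b p).2)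

/-- The polynomial `A = A₁ + A₂ + A₃` (sum of the three monomials, tree's `BB.monomial`). -/
def SMCode.polyA (S : SMCode ℓ m) : BB.Poly ℓ m :=
  BB.monomial (S.amon 0).1 (S.amon 0).2 + BB.monomial (S.amon 1).1 (S.amon 1).2 + BB.monomial (S.amon 2).1 (S.amon 2).2

/-- The polynomial `B = B₁ + B₂ + B₃`. -/
def SMCode.polyB (S : SMCode ℓ m) : BB.Poly ℓ m :=
  BB.monomial (S.bmon 0).1 (S.bmon 0).2 + BB.monomial (S.bmon 1).1 (S.bmon 1).2 + BB.monomial (S.bmon 2).1 (S.bmon 2).2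

/-- The underlying BB code `QC(A, B)` (tree's `BB.Code`). -/
def SMCode.toCode (S : SMCode ℓ m) : BB.Code ℓ m := ⟨S.polyA, S.polyB⟩

/-- The twelve CNOT layers of one syndrome cycle, named by monomial and register pair, in TIME ORDER
(Eq. (SCunitary_part)): R1 `A1RZ`; R2 `A2XL, A3RZ`; R3 `B2XR, B1LZ`; R4 `B1XR, B2LZ`; R5 `B3XR, B3LZ`;
R6 `A1XL, A2RZ`; R7 `A3XL`. [cite: BravyiEtAl2024, SI §5 Eq. (SCunitary_part)] -/
inductive Layer
  | A1RZ | A2XL | A3RZ | B2XR | B1LZ | B1XR | B2LZ | B3XR | B3LZ | A1XL | A2RZ | A3XL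
  deriving DecidableEq, Repr

/-- Control register of a layer (`q(X)` is always a control, `q(Z)` always a target, SI p. 12). -/
def Layer.ctrl : Layer → Reg
  | .A1RZ => .R | .A2XL => .X | .A3RZ => .R | .B2XR => .X | .B1LZ => .L | .B1XR => .X
  | .B2LZ => .L | .B3XR => .X | .B3LZ => .L | .A1XL => .X | .A2RZ => .R | .A3XL => .X

/-- Target register of a layer. -/
def Layer.tgt : Layer → Reg
  | .A1RZ => .Z | .A2XL => .L | .A3RZ => .Z | .B2XR => .R | .B1LZ => .Z | .B1XR => .R
  | .B2LZ => .Z | .B3XR => .R | .B3LZ => .Z | .A1XL => .L | .A2RZ => .Z | .A3XL => .L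

/-- The monomial of a layer. -/
def Layer.mon (S : SMCode ℓ m) : Layer → BB.Mono ℓ m
  | .A1RZ => S.amon 0 | .A2XL => S.amon 1 | .A3RZ => S.amon 2 | .B2XR => S.bmon 1 | .B1LZ => S.bmon 0
  | .B1XR => S.bmon 0 | .B2LZ => S.bmon 1 | .B3XR => S.bmon 2 | .B3LZ => S.bmon 2 | .A1XL => S.amon 0
  | .A2RZ => S.amon 1 | .A3XL => S.amon 2

/-- The idle DATA slots of a cycle: `q(L)` in R1, `q(R)` in R7, `q(L)` and `q(R)` in R8 (ancillas are never idle):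
print's `2n` idle locations per cycle (SI p. 15 L60). -/
inductive IdleSlot
  | L1 | R7 | L8 | R8
  deriving DecidableEq, Repr

/-- Register of an idle slot. -/
def IdleSlot.reg : IdleSlot → Reg
  | .L1 => .L | .R7 => .R | .L8 => .L | .R8 => .R

/-! ## Events (register-wide operations in time order) and faults -/

/-- A register-wide operation of the circuit, tagged with its cycle `c`. -/
inductive Ev
  | initX (c : ℕ) | initZ (c : ℕ) | measX (c : ℕ) | measZ (c : ℕ) | cnot (c : ℕ) (lay : Layer)
  | idle (c : ℕ) (s : IdleSlot)
  deriving DecidableEq, Repr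

/-- The events of cycle `c ≥ 1` in time order (rounds R1 … R8). -/
def cycleEvents (c : ℕ) : List Ev :=
  [.initX c, .cnot c .A1RZ, .idle c .L1,            -- R1
   .cnot c .A2XL, .cnot c .A3RZ,                     -- R2
   .cnot c .B2XR, .cnot c .B1LZ,                     -- R3
   .cnot c .B1XR, .cnot c .B2LZ,                     -- R4
   .cnot c .B3XR, .cnot c .B3LZ,                     -- R5
   .cnot c .A1XL, .cnot c .A2RZ,                     -- R6
   .cnot c .A3XL, .measZ c, .idle c .R7,             -- R7
   .measX c, .initZ c, .idle c .L8, .idle c .R8]     -- R8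

/-- All events of the `Nc`-cycle circuit: cycles `1 … Nc` in order. (The `InitZ q(Z)` preceding cycle 1 — SI p. 12
footnote — is IDEAL here: the simulation starts from the all-clear frame; print's fault count `M = 98·n·N_c` (SI p. 15 L62)
likewise has no location outside the `N_c` cycles. A fault on it would duplicate the cycle-1 `MeasZ`-flip column.) -/
def allEvents (Nc : ℕ) : List Ev :=
  (List.range Nc).flatMap fun c => cycleEvents (c + 1)

/-- A single FAULT of print's circuit-level noise model: a faulty CNOT of layer `lay` with control index `i`
(two-qubit Pauli `(pc, pt)` after the gate), a faulty idle data qubit (Pauli `p`), a faulty `InitX`/`InitZ`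
(orthogonal state) or a flipped `MeasX`/`MeasZ` outcome of ancilla `i` in cycle `c`.
[cite: BravyiEtAl2024, SI §6 p. 15 L12–21] -/
inductive Fault (ℓ m : ℕ)
  | cnot (c : ℕ) (lay : Layer) (i : BB.Mono ℓ m) (pc pt : P1)
  | idle (c : ℕ) (s : IdleSlot) (i : BB.Mono ℓ m) (p : P1)
  | initX (c : ℕ) (i : BB.Mono ℓ m)
  | initZ (c : ℕ) (i : BB.Mono ℓ m)
  | measX (c : ℕ) (i : BB.Mono ℓ m)
  | measZ (c : ℕ) (i : BB.Mono ℓ m)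
  deriving DecidableEq

/-- A fault LOCATION = a faulty operation (the fault with its Pauli forgotten); `faultCount` counts these. -/
inductive Loc (ℓ m : ℕ)
  | cnot (c : ℕ) (lay : Layer) (i : BB.Mono ℓ m)
  | idle (c : ℕ) (s : IdleSlot) (i : BB.Mono ℓ m)
  | initX (c : ℕ) (i : BB.Mono ℓ m)
  | initZ (c : ℕ) (i : BB.Mono ℓ m)
  | measX (c : ℕ) (i : BB.Mono ℓ m)
  | measZ (c : ℕ) (i : BB.Mono ℓ m)
  deriving DecidableEq

omit [NeZero ℓ] [NeZero m] in
/-- The operation a fault sits on. -/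
def Fault.loc : Fault ℓ m → Loc ℓ m
  | .cnot c lay i _ _ => .cnot c lay i | .idle c s i _ => .idle c s i | .initX c i => .initX c i
  | .initZ c i => .initZ c i | .measX c i => .measX c i | .measZ c i => .measZ c i

omit [NeZero ℓ] [NeZero m] in
/-- The event (register-wide operation) during which a fault occurs. -/
def Fault.ev : Fault ℓ m → Ev
  | .cnot c lay _ _ _ => .cnot c lay | .idle c s _ _ => .idle c s | .initX c _ => .initX c
  | .initZ c _ => .initZ c | .measX c _ => .measX c | .measZ c _ => .measZ c

omit [NeZero ℓ] [NeZero m] in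
/-- The number of faulty OPERATIONS of a fault set (distinct locations; two Paulis on one CNOT are ONE
faulty CNOT carrying their product). -/
def faultCount (F : Finset (Fault ℓ m)) : ℕ := (F.image Fault.loc).card

/-! ## Pauli-frame simulation of one fault -/

/-- Simulation state: the current Pauli frame and the accumulated measurement-outcome FLIPS `mX c i`
(`X`-check ancilla `i`, cycle `c`) and `mZ c i`. -/
structure State (ℓ m : ℕ) where
  /-- current Pauli frame -/
  frame : Frame ℓ m
  /-- flips of the `X`-check outcomes, by cycle and check -/
  mX : ℕ → BB.Mono ℓ m → Bool
  /-- flips of the `Z`-check outcomes, by cycle and check -/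
  mZ : ℕ → BB.Mono ℓ m → Bool

/-- The all-clear state. -/
def State.init : State ℓ m := ⟨fun _ => (false, false), fun _ _ => false, fun _ _ => false⟩

/-- The ideal action of an event on the state: CNOT layers conjugate the frame; `MeasX` records the `z`-bit of
each `q(X,i)` (an `X`-basis measurement is flipped by `Z`/`Y`), `MeasZ` the `x`-bit of `q(Z,i)`; ideal
initialisations erase the frame on their register; idles do nothing. -/
def applyEv (S : SMCode ℓ m) : Ev → State ℓ m → State ℓ m
  | .cnot _ lay, st => { st with frame := st.frame.cnotLayer lay.ctrl lay.tgt (lay.mon S) }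
  | .measX c, st => { st with mX := fun c' i => if c' = c then xor (st.mX c' i) (st.frame (.X, i)).2 else st.mX c' i }
  | .measZ c, st => { st with mZ := fun c' i => if c' = c then xor (st.mZ c' i) (st.frame (.Z, i)).1 else st.mZ c' i }
  | .initX _, st => { st with frame := st.frame.clearReg .X }
  | .initZ _, st => { st with frame := st.frame.clearReg .Z }
  | .idle _ _, st => st

/-- Injecting a fault right AFTER its operation: the Pauli(s) enter the frame (CNOT: `pc` on the control
`q(a,i)`, `pt` on the target `q(b, i+μ)`; idle: `p` on the data qubit; `InitX`: `Z`; `InitZ`: `X`), or the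
recorded outcome is flipped (measurement faults). -/
def inject (S : SMCode ℓ m) : Fault ℓ m → State ℓ m → State ℓ m
  | .cnot _ lay i pc pt, st =>
      { st with frame := (st.frame.mulAt (lay.ctrl, i) pc).mulAt (lay.tgt, i + lay.mon S) pt }
  | .idle _ s i p, st => { st with frame := st.frame.mulAt (s.reg, i) p }
  | .initX _ i, st => { st with frame := st.frame.mulAt (.X, i) (false, true) }
  | .initZ _ i, st => { st with frame := st.frame.mulAt (.Z, i) (true, false) }
  | .measX c i, st => { st with mX := fun c' i' => if c' = c ∧ i' = i then !(st.mX c' i') else st.mX c' i' }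
  | .measZ c i, st => { st with mZ := fun c' i' => if c' = c ∧ i' = i then !(st.mZ c' i') else st.mZ c' i' }

/-- Run a list of events with the single fault `f` pending: after the event `f.ev` the fault is injected. -/
def simulate (S : SMCode ℓ m) (f : Fault ℓ m) : List Ev → State ℓ m → State ℓ m
  | [], st => st
  | e :: es, st =>
      let st' := applyEv S e st
      simulate S f es (if e = f.ev then inject S f st' else st')

/-- The final state produced by the single fault `f` in the `Nc`-cycle circuit (all-clear if `f.ev` is not
an event of the circuit). -/
def run1 (S : SMCode ℓ m) (Nc : ℕ) (f : Fault ℓ m) : State ℓ m := simulate S f (allEvents Nc) State.init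

/-! ## Effect of a fault set (𝔽₂-linear = the linearised model), detectors, logical error -/

/-- `𝔽₂`-sum over a finite fault set of a Boolean quantity. -/
def bsum (F : Finset (Fault ℓ m)) (g : Fault ℓ m → Bool) : Bool := (F.filter fun f => g f = true).card % 2 == 1

/-- Total flip of the `X`-check outcome `(c, i)` caused by the fault set `F`. -/
def flipX (S : SMCode ℓ m) (Nc : ℕ) (F : Finset (Fault ℓ m)) (c : ℕ) (i : BB.Mono ℓ m) : Bool :=
  bsum F fun f => (run1 S Nc f).mX c i

/-- Total flip of the `Z`-check outcome `(c, i)`. -/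
def flipZ (S : SMCode ℓ m) (Nc : ℕ) (F : Finset (Fault ℓ m)) (c : ℕ) (i : BB.Mono ℓ m) : Bool :=
  bsum F fun f => (run1 S Nc f).mZ c i

/-- The residual `X`-type error on the DATA qubits at the end (as a vector over the code's column index
`Mono ⊕ Mono`: left block `q(L)`, right block `q(R)`). -/
def dataX (S : SMCode ℓ m) (Nc : ℕ) (F : Finset (Fault ℓ m)) : BB.Mono ℓ m ⊕ BB.Mono ℓ m → ZMod 2 :=
  fun q => if bsum F (fun f => ((run1 S Nc f).frame (q.elim (fun i => (Reg.L, i)) fun i => (Reg.R, i))).1)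
    then 1 else 0

/-- The residual `Z`-type error on the data qubits at the end. -/
def dataZ (S : SMCode ℓ m) (Nc : ℕ) (F : Finset (Fault ℓ m)) : BB.Mono ℓ m ⊕ BB.Mono ℓ m → ZMod 2 :=
  fun q => if bsum F (fun f => ((run1 S Nc f).frame (q.elim (fun i => (Reg.L, i)) fun i => (Reg.R, i))).2)
    then 1 else 0

/-- `X`-check DETECTOR `(t, i)`, `t = 1 … Nc+1`: the change of the `X`-check outcome between cycles `t−1` and
`t` (cycle `0` = the perfect initial code state, all syndromes `0`), and for `t = Nc+1` the perfect final
syndrome `(H^X β)_i` of the residual `Z`-error compared with the last measured outcome. `false` elsewhere. -/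
def detX (S : SMCode ℓ m) (Nc : ℕ) (F : Finset (Fault ℓ m)) (t : ℕ) (i : BB.Mono ℓ m) : Bool :=
  if t = 0 then false
  else if t ≤ Nc then xor (flipX S Nc F t i) (flipX S Nc F (t - 1) i)
  else if t = Nc + 1 then xor (decide ((S.toCode.HX.mulVec (dataZ S Nc F)) i = 1)) (flipX S Nc F Nc i)
  else false

/-- `Z`-check DETECTOR `(t, i)` (symmetric: `Z`-check outcome changes, final `(H^Z α)_i` of the residual
`X`-error). -/
def detZ (S : SMCode ℓ m) (Nc : ℕ) (F : Finset (Fault ℓ m)) (t : ℕ) (i : BB.Mono ℓ m) : Bool :=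
  if t = 0 then false
  else if t ≤ Nc then xor (flipZ S Nc F t i) (flipZ S Nc F (t - 1) i)
  else if t = Nc + 1 then xor (decide ((S.toCode.HZ.mulVec (dataX S Nc F)) i = 1)) (flipZ S Nc F Nc i)
  else false

/-- A fault set is UNDETECTABLE in the `Nc`-cycle circuit: every fault sits on an operation of the circuit and
no detector fires ("generated without triggering any syndromes", p. 5; zero column-sum of the decoding matrix
`D`, SI p. 16). -/
def Undetectable (S : SMCode ℓ m) (Nc : ℕ) (F : Finset (Fault ℓ m)) : Prop :=
  (∀ f ∈ F, f.ev ∈ allEvents Nc) ∧ ∀ t i, detX S Nc F t i = false ∧ detZ S Nc F t i = false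

/-- The residual data error `X(α)Z(β)` is a LOGICAL ERROR: it is not a product of check operators, i.e. not
(`α ∈ rs H^X` and `β ∈ rs H^Z`) — for an undetectable set `α ∈ ker H^Z`, `β ∈ ker H^X`, so this says the
error is a non-trivial logical Pauli ("differs from the initial encoded state", p. 5; non-zero logical
syndrome `s^L`, SI p. 15). -/
def LogicalError (S : SMCode ℓ m) (Nc : ℕ) (F : Finset (Fault ℓ m)) : Prop :=
  ¬ (dataX S Nc F ∈ S.toCode.css.rowSpX ∧ dataZ S Nc F ∈ S.toCode.css.swap.rowSpX)

/-- **Circuit-level distance** `d_circ` of the `Nc`-cycle SM circuit of `S`: the least number of faulty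
operations of an undetectable fault set causing a logical error (p. 5 L50–55; SI p. 17). `sInf`: junk value
`0` if no such set exists (never the case for `Nc ≥ 1`: a minimum-weight logical on idle data qubits is one).
[cite: BravyiEtAl2024, §2 p. 5 ("it takes at least d_circ faulty operations … undetectable logical error")] -/
noncomputable def circuitDistance (S : SMCode ℓ m) (Nc : ℕ) : ℕ :=
  sInf {w | ∃ F : Finset (Fault ℓ m), Undetectable S Nc F ∧ LogicalError S Nc F ∧ faultCount F = w}

/-- The `Nc`-cycle circuit admits an undetectable logical fault set with at most `w` faulty operations
(`⟺ circuitDistance S Nc ≤ w` whenever some undetectable logical fault set exists). The WINDOW LEMMA of the cell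
(to be proved in `Theorems/`: every single fault meets detector layers `{c, c+1}` only, so a minimum-weight set has no
fault-free cycle inside its span) reads `HasLogicalFaultOfWeightAtMostAt S Nc w ↔ HasLogicalFaultOfWeightAtMostAt S (min Nc w) w`. -/
def HasLogicalFaultOfWeightAtMostAt (S : SMCode ℓ m) (Nc w : ℕ) : Prop :=
  ∃ F : Finset (Fault ℓ m), Undetectable S Nc F ∧ LogicalError S Nc F ∧ faultCount F ≤ w

/-- There is an undetectable logical fault set with at most `w` faulty operations in SOME number of cycles —
the shape of the pre-registered questions CDX-Q1/Q2 (`w = 5` for `[[72,12,6]]`, `w = 9` for `[[144,12,12]]`). -/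
def HasLogicalFaultOfWeightAtMost (S : SMCode ℓ m) (w : ℕ) : Prop :=
  ∃ Nc : ℕ, HasLogicalFaultOfWeightAtMostAt S Nc w

/-! ## The two circuits of the experiment -/

omit [NeZero ℓ] [NeZero m] in
/-- The SM-circuit data of `[[72,12,6]]`: `ℓ = m = 6`, `A₁ = x³, A₂ = y, A₃ = y²`, `B₁ = y³, B₂ = x, B₃ = x²`.
LABELLING OF RECORD (the circuit, hence `d_circ`, depends on it — relabelling `A₁ ↔ A₂` is one of print's 935 other
depth-7 circuits): the `A`-labels are printed ("`A = x³+y+y²`, `A₂ = y`, and `A₃ = y²`", SI p. 10 L83); the `B`-labels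
follow print's positional convention `B = B₁ + B₂ + B₃` read off "`B = y³+x+x²`" (§4 p. 9 L21–23; convention corroborated
by the toric-layout computations p. 11) — the authors' software labelling is provenance, not checked here.
[cite: BravyiEtAl2024, Table 1 row [[72,12,6]] and SI §4 p. 9 L21–23, p. 10 L83] -/
def bb72SM : SMCode 6 6 := ⟨![(3, 0), (0, 1), (0, 2)], ![(0, 3), (1, 0), (2, 0)]⟩

omit [NeZero ℓ] [NeZero m] in
/-- The SM-circuit data of the "gross" code `[[144,12,12]]`: `ℓ = 12, m = 6`, same ordered terms and the same
labelling of record as `bb72SM` (`A`-labels printed at SI p. 10 L83 for THIS code; `B`-labels positional).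
[cite: BravyiEtAl2024, Table 1 row [[144,12,12]] and SI §4 p. 9 L21–23, p. 10 L83] -/
def bb144SM : SMCode 12 6 := ⟨![(3, 0), (0, 1), (0, 2)], ![(0, 3), (1, 0), (2, 0)]⟩

omit [NeZero ℓ] [NeZero m] in
/-- `bb72SM` is a circuit FOR the tree's code `BB.bb72` (same `A`, `B`). -/
theorem bb72SM_toCode : bb72SM.toCode = BB.bb72 := by
  have hA : bb72SM.polyA = BB.bb72.A := by decide
  have hB : bb72SM.polyB = BB.bb72.B := by decide
  unfold SMCode.toCode; rw [hA, hB]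

omit [NeZero ℓ] [NeZero m] in
/-- `bb144SM` is a circuit for the tree's code `BB.bb144`. -/
theorem bb144SM_toCode : bb144SM.toCode = BB.bb144 := by
  have hA : bb144SM.polyA = BB.bb144.A := by decide
  have hB : bb144SM.polyB = BB.bb144.B := by decide
  unfold SMCode.toCode; rw [hA, hB]

end Summit.Ventures.QEC.CircuitDistance
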